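import Mathlib
import Literature.Computability.MetaComplexity.SmolenskyDimensionBound

/-!
# The exact dimension of Smolensky's degree filtration

`dim lowDeg F n k = Σ_{i ≤ k} C(n, i)`: the `2ⁿ` monomials `x_S`, `S ⊆ [n]`, span the
`2ⁿ`-dimensional space of functions on the cube, hence are linearly independent, so those with
`|S| ≤ k` form a basis of `lowDeg F n k`. Helper for line Sketch/LAR of crux
stmt-QuantumAdvantage-1392 (the tree only has the inequality `Smolensky.finrank_lowDeg_le`).
-/

namespace Summit.QuantumAdvantage.DigitPolyUniformity.SketchLAR

open Finset Module
open Literature.Computability.MetaComplexity.Smolensky (CubeFn mono lowDeg)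

namespace FinrankLowDeg

/-- The monomials `x_S`, `S ⊆ [n]`, are linearly independent as functions on the cube `{0,1}ⁿ`
(there are `2ⁿ` of them and they span the `2ⁿ`-dimensional space `CubeFn F n`). [folklore] -/
theorem linearIndependent_mono {F : Type*} [Field F] (n : ℕ) :
    LinearIndependent F (mono F (n := n)) := by
  refine linearIndependent_of_top_le_span_of_card_eq_finrank ?_ ?_
  · rw [Literature.Computability.MetaComplexity.Smolensky.span_range_mono_eq_top]
  · rw [Literature.Computability.MetaComplexity.Smolensky.finrank_cubeFn, Fintype.card_finset,
      Fintype.card_fin]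

/-- The monomials `x_S` with `|S| ≤ k` are linearly independent. [folklore] -/
theorem linearIndependent_mono_subtype {F : Type*} [Field F] (n k : ℕ) :
    LinearIndependent F (fun S : {S : Finset (Fin n) // S.card ≤ k} => mono F S.1) :=
  (linearIndependent_mono n).comp _ Subtype.val_injective

/-- A subset of `[n]` has size `≤ k` iff it lies in one of the levels `powersetCard i univ`,
`i ≤ k`. [folklore] -/
theorem card_le_iff_mem_biUnion (n k : ℕ) (S : Finset (Fin n)) :
    S.card ≤ k ↔ S ∈ (range (k + 1)).biUnion fun i => powersetCard i (univ : Finset (Fin n)) := by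
  simp only [Finset.mem_biUnion, Finset.mem_range, Finset.mem_powersetCard, Finset.subset_univ,
    true_and]
  constructor
  · exact fun h => ⟨S.card, Nat.lt_succ_of_le h, rfl⟩
  · rintro ⟨i, hi, rfl⟩
    exact Nat.le_of_lt_succ hi

/-- The levels `powersetCard i univ` are pairwise disjoint (their members have different
cardinalities). [folklore] -/
theorem pairwiseDisjoint_powersetCard (n k : ℕ) :
    ((range (k + 1) : Finset ℕ) : Set ℕ).PairwiseDisjoint
      fun i => powersetCard i (univ : Finset (Fin n)) :=
  fun _ _ _ _ hij => Finset.pairwise_disjoint_powersetCard _ hij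

/-- The number of subsets of `[n]` of size at most `k` is `Σ_{i ≤ k} C(n, i)`. [folklore] -/
theorem card_subtype_card_le (n k : ℕ) :
    Fintype.card {S : Finset (Fin n) // S.card ≤ k} = ∑ i ∈ range (k + 1), n.choose i := by
  rw [Fintype.card_of_subtype _ (fun S => (card_le_iff_mem_biUnion n k S).symm),
    Finset.card_biUnion (pairwiseDisjoint_powersetCard n k)]
  refine Finset.sum_congr rfl fun i _ => ?_
  rw [Finset.card_powersetCard, Finset.card_univ, Fintype.card_fin]

end FinrankLowDeg

/-- **The dimension of the degree filtration**: `dim lowDeg F n k = Σ_{i ≤ k} C(n, i)`, the number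
of multilinear monomials of degree `≤ k` (these monomials form a basis). [folklore] -/
theorem stub_finrank_lowDeg {F : Type*} [Field F] (n k : ℕ) :
    Module.finrank F ↥(lowDeg F n k) = ∑ i ∈ range (k + 1), n.choose i := by
  rw [Literature.Computability.MetaComplexity.Smolensky.lowDeg_eq_span,
    finrank_span_eq_card (FinrankLowDeg.linearIndependent_mono_subtype n k),
    FinrankLowDeg.card_subtype_card_le]

end Summit.QuantumAdvantage.DigitPolyUniformity.SketchLAR
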